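import Literature.NumberTheory.LFunctions.ConreyIwaniec2002Prop64OfOne
import Literature.NumberTheory.LFunctions.ConreyIwaniec2002ShiftedConvolutionOf
import Literature.NumberTheory.LFunctions.ConreyIwaniec2002CircleMethodAssembly
import Literature.NumberTheory.LFunctions.ConreyIwaniec2002HeckeVoronoi
import Literature.NumberTheory.LFunctions.ConreyIwaniec2002SigmaGenus
import HarnessLib

/-!
# Conrey–Iwaniec (2002), Proposition 6.4 modulo the Bessel-kernel bound (4.5) and the theta `ω`-relation

B. Conrey, H. Iwaniec, Acta Arith. 103 (2002) 259–312, Theorems 4.3/4.4 (p. 270) and Proposition 6.4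
[held text `paper:arxiv-math_0111012`, p0012, p0014–p0017]. With S3a, S3b (Theorem 4.1: `bump_fourier`,
`zeroDetectorIdentity_holds`, `incomplete_kloosterman`, `CircleMethod.circle_assembly`), S3e
(`sigma_genus`), S3f (`circleMethod_absorb_constants`), V2 (`hecke_voronoi`) and V3 (`theta_constants`,
inside `voronoi_theta_of_omega_hecke`) all tree theorems, the registered S3 statement of SKELETON P64 —
Theorems 4.3/4.4 for the class-group theta series — and hence the typed `conreyIwaniec2002_proposition64`
follow from the TWO remaining registered stubs of the cell `landau-siegel/ls-inputs`, lines
`theta-circle-method` / `theta-voronoi`: S3c `stub_bessel_kernel` ((4.5) for `J₀((4π/c)√(mx/r))`,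
`B = B₀q^{3/2}`) and V1 `stub_theta_omega` (the `ω`-relation (2.23)–(2.39) behind Propositions 3.2/3.3),
both taken verbatim as hypotheses. The proof is the kernel composition of SKELETON S3 with the landed
stubs by name. Seat ls-inputs-P64-lead g2. No claim about Landau–Siegel zeros.

## References
* [ConreyIwaniec2002] B. Conrey, H. Iwaniec, Acta Arith. 103 (2002) 259–312: Theorems 4.3/4.4
  (4.25)–(4.26), Proposition 6.4 (6.52).
-/

noncomputable section

open scoped NumberField FourierTransform
open Complex MeasureTheory

namespace Literature.NumberTheory.LFunctions

namespace ConreyIwaniec2002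

open NumberField Literature.NumberTheory.LFunctions.NumberField
open Literature.Analysis.FunctionSpaces (besselJ)

/-- An odd Dirichlet character is not trivial. [folklore] -/
private theorem ne_one_of_odd'' {q : ℕ} [NeZero q] {χ : DirichletCharacter ℂ q} (hodd : χ.Odd) :
    χ ≠ 1 := by
  rintro rfl
  have h : ((1 : DirichletCharacter ℂ q) (-1) : ℂ) = -1 := hodd
  rw [MulChar.one_apply (isUnit_one.neg)] at h
  norm_num at h

/-- **Theorems 4.3/4.4 for `λ_ψ` (the registered S3 statement of SKELETON P64, verbatim) from
S3c `stub_bessel_kernel` and V1 `stub_theta_omega`** — the kernel composition of SKELETON S3 with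
S3a/S3b/S3e/S3f/V2/V3 by name. [cite: ConreyIwaniec2002, Theorem 4.3 (4.25), Theorem 4.4 (4.26)] -/
theorem shifted_convolution_of_bessel_kernel_theta_omega
    (hc :
    ∃ B₀ : ℝ, 1 ≤ B₀ ∧ ∀ (q : ℕ), 1 ≤ q → ∀ r : ℕ → ℕ, (∀ c : ℕ, 1 ≤ r c ∧ r c ≤ q) →
      KernelFourierBound q (B₀ * (q : ℝ) ^ (3 / 2 : ℝ)) (ciBesselKernel r))
    (hV1 :
    ∀ (q : ℕ) [NeZero q], 4 < q → Odd q → ∀ χ : DirichletCharacter ℂ q,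
      χ.IsPrimitive → χ.IsQuadratic → χ.Odd →
        ∀ (K : Type) [Field K] [NumberField K],
          Module.finrank ℚ K = 2 → NumberField.discr K = -(q : ℤ) →
            ∀ (ψ : ClassGroup (𝓞 K) →* ℂˣ) (c : ℕ), 1 ≤ c →
              ∃ ψ' : ClassGroup (𝓞 K) →* ℂˣ, IsGenusCharFor (ψ' * ψ⁻¹) (Nat.gcd c q) ∧
                ∀ a abar : ℤ, a * abar ≡ 1 [ZMOD c] →
                  ∃ η : ℂ, ‖η‖ = 1 ∧
                    IsOmegaRelated ((c : ℝ) * Real.sqrt (q / Nat.gcd c q : ℕ)) η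
                      (twistCount K (classGroupCharIdealHom ψ))
                      (twistCount K (classGroupCharIdealHom ψ'))
                      (thetaConst K ψ) (thetaConst K ψ')
                      ((a : ℝ) / c)
                      (-((abar * ((((q / Nat.gcd c q : ℕ) : ZMod c)⁻¹).val : ℤ) : ℤ) : ℝ) / c)) :
    ∃ c : ℝ, 0 < c ∧
      ∀ (q : ℕ) [NeZero q], 4 < q → Odd q → ∀ χ : DirichletCharacter ℂ q,
        χ.IsPrimitive → χ.IsQuadratic → χ.Odd →
          ∀ (K : Type) [Field K] [NumberField K],
            Module.finrank ℚ K = 2 → NumberField.discr K = -(q : ℤ) →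
              ∀ (ψ : ClassGroup (𝓞 K) →* ℂˣ),
                ∃ σ : ℕ → ℝ, IsCISigma q ‖χ.LFunction 1‖ σ ∧
                  ShiftedConvolutionBound (twistCount K (classGroupCharIdealHom ψ)) σ
                    (c * (q : ℝ) ^ (6 : ℕ)) := by
  obtain ⟨c₁, hc₁, hF⟩ := bump_fourier
  obtain ⟨K₀, hK₀, hKl⟩ := incomplete_kloosterman
  obtain ⟨c₀, hc₀, hCM⟩ := CircleMethod.circle_assembly c₁ K₀ hc₁ hK₀ hF zeroDetectorIdentity_holds hKl
  obtain ⟨B₀, hB₀, hKer⟩ := hc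
  obtain ⟨c, hcpos, habs⟩ := circleMethod_absorb_constants c₀ B₀ hc₀ hB₀
  have hVor := voronoi_theta_of_omega_hecke hV1 hecke_voronoi
  refine ⟨c, hcpos, ?_⟩
  intro q _ hq hodd χ hprim hquad hoddχ K _ _ h2 hdisc ψ
  set ℓ : ℝ := ‖χ.LFunction 1‖ with hℓ
  set lam : ℕ → ℂ := twistCount K (classGroupCharIdealHom ψ) with hlam
  set p : ℕ → ℝ := voronoiMainCoeff q ℓ ψ with hp
  set rr : ℕ → ℕ := fun c ↦ q / Nat.gcd c q with hrr
  -- S3d (from V1, V2, V3): the summation datum; S3e: the main-term coefficients are admissible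
  obtain ⟨u, φ, hV⟩ := hVor q hq hodd χ hprim hquad hoddχ K h2 hdisc ψ
  refine ⟨ciSigma p, sigma_genus q hq hodd χ hprim hquad hoddχ K h2 hdisc ψ, ?_⟩
  intro X hX g₁ g₂ hg₁ hg₂ h hh
  -- numerics
  have hq5 : (5 : ℝ) ≤ q := by exact_mod_cast hq
  have hq2 : 2 ≤ q := by omega
  have hq1 : 1 ≤ q := by omega
  have hℓ0 : 0 ≤ ℓ := norm_nonneg _
  have hℓlog : ℓ ≤ Real.log q := DirichletAbel.norm_LFunction_one_le_log χ (ne_one_of_odd'' hoddχ)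
  have hA : 1 ≤ 2 * Real.pi + Real.sqrt q * ℓ := by
    have : 0 ≤ Real.sqrt q * ℓ := by positivity
    linarith [Real.pi_gt_three]
  have hB : 1 ≤ B₀ * (q : ℝ) ^ (3 / 2 : ℝ) := by
    have h1 : (1 : ℝ) ≤ (q : ℝ) ^ (3 / 2 : ℝ) := Real.one_le_rpow (by linarith) (by norm_num)
    nlinarith
  -- S3c: (4.5) for the Bessel kernels with `r = q/(c,q)`
  have hrr1 : ∀ c : ℕ, 1 ≤ rr c ∧ rr c ≤ q := by
    intro c
    refine ⟨?_, Nat.div_le_self q _⟩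
    have hg : 0 < Nat.gcd c q := Nat.gcd_pos_of_pos_right c (by omega)
    exact (Nat.one_le_div_iff hg).mpr (Nat.le_of_dvd (by omega) (Nat.gcd_dvd_right c q))
  have hK := hKer q hq1 rr hrr1
  -- S3b: the circle method
  have hmain := hCM q hq2 _ _ hA hB lam (ciBesselKernel rr) p u φ _ hV hK X hX g₁ g₂ hg₁ hg₂ h hh
  -- S3f: absorption
  have hfin := habs q X ℓ hq5 hX hℓ0 hℓlog
  have hτ : (0 : ℝ) ≤ (Nat.divisors h).card := Nat.cast_nonneg _
  calc ‖(∑ n ∈ Finset.Icc 1 ⌊2 * X⌋₊,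
            lam (n + h) * starRingEnd ℂ (lam n) * g₁ ((n : ℝ) + h) * g₂ n) -
          (ciSigma p h : ℂ) * ∫ x : ℝ, g₁ (x + h) * g₂ x‖
      ≤ c₀ * (Nat.divisors h).card * (2 * Real.pi + Real.sqrt q * ℓ) ^ 2 *
          (X / Real.sqrt (q * X) +
            q * (B₀ * (q : ℝ) ^ (3 / 2 : ℝ)) ^ 2 * ((q : ℝ) * X) ^ (3 / 4 : ℝ) *
              (1 + Real.log (q * X)) ^ 2) := hmain
    _ = (Nat.divisors h).card * (c₀ * (2 * Real.pi + Real.sqrt q * ℓ) ^ 2 *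
          (X / Real.sqrt (q * X) +
            q * (B₀ * (q : ℝ) ^ (3 / 2 : ℝ)) ^ 2 * ((q : ℝ) * X) ^ (3 / 4 : ℝ) *
              (1 + Real.log (q * X)) ^ 2)) := by ring
    _ ≤ (Nat.divisors h).card * (c * (q : ℝ) ^ (6 : ℕ) * X ^ (3 / 4 : ℝ) * Real.log (3 * X) ^ 2) :=
        mul_le_mul_of_nonneg_left hfin hτ
    _ = c * (q : ℝ) ^ (6 : ℕ) * (Nat.divisors h).card * X ^ (3 / 4 : ℝ) * Real.log (3 * X) ^ 2 := by
        ring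

/-- **Proposition 6.4 from S3c and V1 alone.** [cite: ConreyIwaniec2002, Proposition 6.4 (6.52)] -/
theorem proposition64_of_bessel_kernel_theta_omega
    (hc :
    ∃ B₀ : ℝ, 1 ≤ B₀ ∧ ∀ (q : ℕ), 1 ≤ q → ∀ r : ℕ → ℕ, (∀ c : ℕ, 1 ≤ r c ∧ r c ≤ q) →
      KernelFourierBound q (B₀ * (q : ℝ) ^ (3 / 2 : ℝ)) (ciBesselKernel r))
    (hV1 :
    ∀ (q : ℕ) [NeZero q], 4 < q → Odd q → ∀ χ : DirichletCharacter ℂ q,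
      χ.IsPrimitive → χ.IsQuadratic → χ.Odd →
        ∀ (K : Type) [Field K] [NumberField K],
          Module.finrank ℚ K = 2 → NumberField.discr K = -(q : ℤ) →
            ∀ (ψ : ClassGroup (𝓞 K) →* ℂˣ) (c : ℕ), 1 ≤ c →
              ∃ ψ' : ClassGroup (𝓞 K) →* ℂˣ, IsGenusCharFor (ψ' * ψ⁻¹) (Nat.gcd c q) ∧
                ∀ a abar : ℤ, a * abar ≡ 1 [ZMOD c] →
                  ∃ η : ℂ, ‖η‖ = 1 ∧
                    IsOmegaRelated ((c : ℝ) * Real.sqrt (q / Nat.gcd c q : ℕ)) η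
                      (twistCount K (classGroupCharIdealHom ψ))
                      (twistCount K (classGroupCharIdealHom ψ'))
                      (thetaConst K ψ) (thetaConst K ψ')
                      ((a : ℝ) / c)
                      (-((abar * ((((q / Nat.gcd c q : ℕ) : ZMod c)⁻¹).val : ℤ) : ℤ) : ℝ) / c)) :
    conreyIwaniec2002_proposition64 :=
  proposition64_of_shiftedConvolution (shifted_convolution_of_bessel_kernel_theta_omega hc hV1)

end ConreyIwaniec2002

end Literature.NumberTheory.LFunctions

end
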